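import Summits.NavierStokesRegularity.NavierStokesRegularity.Theorems.ScalingDefectPeepholeDoorSerrinClassical
import Literature.Analysis.FluidPDE.ClassicalSolutionRegionRescale
import HarnessLib

/-!
# ScalingDefectPeepholeDoorSerrinTypeI — door S30 «ScalingDefectPeepholeDoor», effective plate E0 (step E4):
# one-slice derivative bounds under the Type I envelope with an ABSOLUTE scale

Ninth file of the pressure-free Serrin chain: the PRESSURE-FREE twin of the tree's
`Literature.Analysis.FluidPDE.exists_forall_iteratedFDeriv_le_of_typeI_of_bounds` (Pineau–Vicol 2026,
Lemma 9.1/9.2, (9.3): `|∇ᵏu(x,t)| ≤ C(k, C_u)(|x| + √(-t))^{-k-1}`).  In the tree that lemma produces the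
constant `K(n, C_u)` but a scale of validity `c₁(B_u, B_p)` depending on the pressure level, because it runs
the ε-regularity route; here **`c₁ = 1/2` is absolute**: for every order `n` and Type-I constant `C_u`
there is `K = K(n, C_u)` such that every classical solution on `[-1, 0) × B(0, 1)` with
`|u(t, x)| ≤ C_u / (√(-t) + |x|)` satisfies `‖D_xⁿ u(t, ·)(x)‖ ≤ K / (|x| + √(-t))^{n+1}` whenever
`|x| + √(-t) ≤ 1/2`, `t > -1` — proof: zoom by `ϱ = (|x| + √(-t))/4` about `(t, x)`
(`IsClassicalNSSolutionOnRegion.nsRescale_translate_of_isOpen`), where the envelope gives `|v| ≤ C_u/3`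
on `Q*_1(-1, 0)`, apply Serrin's pressure-free bound `Serrin.norm_iteratedFDeriv_le_of_classical`
(step E3c) below the top, undo the zoom, and pass to the top slice by continuity.

Door S30 is a regularity CRITERION inside a HYPOTHETICAL local Type-I blow-up; item 0056 `NoTypeII`
stays OPEN; nothing here bears on NS regularity itself.
-/

noncomputable section

set_option linter.dupNamespace false

namespace Summit.NavierStokesRegularity.NavierStokesRegularity.Theorems.ScalingDefectPeepholeDoor

namespace Serrin

open MeasureTheory Set Function Filter Topology TopologicalSpace Metric InnerProductSpace
open scoped NNReal ENNReal RealInnerProductSpace Laplacian ContDiff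
open Literature.Analysis Literature.Analysis.FluidPDE

/-- **Chain rule for a homothety, in norm**: `‖Dᵏ[ψ(b ·)](x)‖ ≤ |b|ᵏ ‖Dᵏψ(bx)‖` for `b ≠ 0`, without
any differentiability hypothesis (twin of `KNSSLocalSmoothing`'s lemma, kept out of the import
closure). [folklore] -/
theorem norm_iteratedFDeriv_comp_smul_le' {F : Type*} [NormedAddCommGroup F] [NormedSpace ℝ F]
    (ψ : EuclideanSpace ℝ (Fin 3) → F) {b : ℝ} (hb : b ≠ 0) (k : ℕ) (x : EuclideanSpace ℝ (Fin 3)) :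
    ‖iteratedFDeriv ℝ k (fun y => ψ (b • y)) x‖ ≤ |b| ^ k * ‖iteratedFDeriv ℝ k ψ (b • x)‖ := by
  set e : EuclideanSpace ℝ (Fin 3) ≃L[ℝ] EuclideanSpace ℝ (Fin 3) := ContinuousLinearEquiv.equivOfInverse
    (b • ContinuousLinearMap.id ℝ (EuclideanSpace ℝ (Fin 3)))
    (b⁻¹ • ContinuousLinearMap.id ℝ (EuclideanSpace ℝ (Fin 3))) (fun y => by simp [smul_smul, hb])
    (fun y => by simp [smul_smul, hb]) with he
  have hee : ∀ y, e y = b • y := fun y => rfl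
  have hcomp : (fun y => ψ (b • y)) = ψ ∘ e := rfl
  have h := e.iteratedFDerivWithin_comp_right ψ uniqueDiffOn_univ (mem_univ (e x)) k
  simp only [preimage_univ, iteratedFDerivWithin_univ] at h
  rw [hcomp, h, hee x, mul_comm]
  refine (ContinuousMultilinearMap.norm_compContinuousLinearMap_le _ _).trans ?_
  rw [Finset.prod_const, Finset.card_univ, Fintype.card_fin]
  refine mul_le_mul_of_nonneg_left (pow_le_pow_left₀ (norm_nonneg _) ?_ k) (norm_nonneg _)
  refine ContinuousLinearMap.opNorm_le_bound _ (abs_nonneg b) fun y => ?_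
  rw [ContinuousLinearEquiv.coe_coe, hee y, norm_smul, Real.norm_eq_abs]

set_option maxHeartbeats 1600000 in
/-- **One-slice derivative bounds under the Type I envelope, pressure-free, absolute scale**
(Pineau–Vicol 2026, Lemma 9.1/9.2 (9.3) as printed: `C_{k} = C(k, C_u)`; Serrin 1962; Chen–Strain–Tsai–Yau
2009, Lemma A.2). For `n : ℕ` and `C_u` there is `K = K(n, C_u) ≥ 0` such that every classical solution
`(u, p)` (`ν = 1`, `f = 0`) on `[-1, 0) × B(0, 1)` with `|u(t, x)| ≤ C_u / (√(-t) + |x|)` there satisfies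
`‖D_xⁿ u(t, ·)(x)‖ ≤ K / (|x| + √(-t))^{n+1}` for all `t ∈ (-1, 0)` and `|x| + √(-t) ≤ 1/2`; the scale
`c₁ = 1/2` does not depend on the solution or on the pressure. [folklore] -/
theorem exists_forall_iteratedFDeriv_le_of_typeI_pfree (n : ℕ) (Cu : ℝ) :
    ∃ K : ℝ, 0 ≤ K ∧ ∃ c₁ : ℝ, 0 < c₁ ∧
      ∀ (u : ℝ → EuclideanSpace ℝ (Fin 3) → EuclideanSpace ℝ (Fin 3)) (p : ℝ → EuclideanSpace ℝ (Fin 3) → ℝ),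
        IsClassicalNSSolutionOnRegion (Ico (-1 : ℝ) 0 ×ˢ ball (0 : EuclideanSpace ℝ (Fin 3)) 1) 1 0 u p →
        (∀ t ∈ Ico (-1 : ℝ) 0, ∀ x ∈ ball (0 : EuclideanSpace ℝ (Fin 3)) 1,
          ‖u t x‖ ≤ Cu / (Real.sqrt (-t) + ‖x‖)) →
        ∀ t ∈ Ioo (-1 : ℝ) 0, ∀ x : EuclideanSpace ℝ (Fin 3), ‖x‖ + Real.sqrt (-t) ≤ c₁ →
          ‖iteratedFDeriv ℝ n (u t) x‖ ≤ K / (‖x‖ + Real.sqrt (-t)) ^ (n + 1) := by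
  obtain ⟨K, hK0, hK⟩ := norm_iteratedFDeriv_le_of_classical n (R := 1) (r' := 1 / 2) (by norm_num)
    (by norm_num) (Cu / 3)
  refine ⟨K * 4 ^ (n + 1), by positivity, 1 / 2, by norm_num, fun u p hcl hTI t ht x hx => ?_⟩
  -- the sign of `C_u`
  have hCu : 0 ≤ Cu := by
    have h := hTI (-1 / 2) ⟨by norm_num, by norm_num⟩ 0 (mem_ball_self one_pos)
    have hs : 0 < Real.sqrt (-(-1 / 2 : ℝ)) + ‖(0 : EuclideanSpace ℝ (Fin 3))‖ := by
      rw [norm_zero, add_zero]; exact Real.sqrt_pos.2 (by norm_num)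
    by_contra hneg
    have : Cu / (Real.sqrt (-(-1 / 2 : ℝ)) + ‖(0 : EuclideanSpace ℝ (Fin 3))‖) < 0 :=
      div_neg_of_neg_of_pos (not_le.1 hneg) hs
    exact ((norm_nonneg _).trans h).not_gt this
  -- the scale
  set ϱ₀ : ℝ := ‖x‖ + Real.sqrt (-t) with hϱ₀
  have hst : 0 < Real.sqrt (-t) := Real.sqrt_pos.2 (by linarith [ht.2])
  have hϱ₀0 : 0 < ϱ₀ := by rw [hϱ₀]; positivity
  set c : ℝ := ϱ₀ / 4 with hc
  have hc0 : 0 < c := by positivity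
  have hc8 : c ≤ 1 / 8 := by rw [hc]; linarith
  have ht4 : -1 / 4 ≤ t := by
    have h1 : Real.sqrt (-t) ≤ 1 / 2 := by linarith [norm_nonneg x]
    have h2 : -t ≤ 1 / 4 := by
      have := Real.sq_sqrt (show (0:ℝ) ≤ -t by linarith [ht.2])
      nlinarith [Real.sqrt_nonneg (-t)]
    linarith
  -- the open region of smoothness
  set Ω : Set (ℝ × EuclideanSpace ℝ (Fin 3)) := Ioo (-1 : ℝ) 0 ×ˢ ball (0 : EuclideanSpace ℝ (Fin 3)) 1 with hΩ
  have hΩo : IsOpen Ω := isOpen_Ioo.prod isOpen_ball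
  have hΩsub : Ω ⊆ Ico (-1 : ℝ) 0 ×ˢ ball (0 : EuclideanSpace ℝ (Fin 3)) 1 :=
    prod_mono Ioo_subset_Ico_self le_rfl
  have hclΩ : IsClassicalNSSolutionOnRegion Ω 1 0 u p := hcl.mono_of_isOpen hΩsub hΩo
  -- the zoom `v(s, y) = c u(t + c²s, x + c y)`
  set v : ℝ → EuclideanSpace ℝ (Fin 3) → EuclideanSpace ℝ (Fin 3) := c • stPull (c ^ 2) c t x u with hv
  set π : ℝ → EuclideanSpace ℝ (Fin 3) → ℝ := c ^ 2 • stPull (c ^ 2) c t x p with hπ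
  have hzoom := hclΩ.nsRescale_translate_of_isOpen hΩo hc0 t x
  have e0 : ((c ^ 2 * c) • stPull (c ^ 2) c t x
      (0 : ℝ → EuclideanSpace ℝ (Fin 3) → EuclideanSpace ℝ (Fin 3))) = 0 := by
    funext s y; simp [stPull]
  rw [e0] at hzoom
  -- the centred cylinder `Q*_1(-1, 0)` lies in the preimage region
  set z₁ : ℝ × EuclideanSpace ℝ (Fin 3) := ((-(1:ℝ) ^ 2 : ℝ), (0 : EuclideanSpace ℝ (Fin 3))) with hz₁
  set Qs : Set (ℝ × EuclideanSpace ℝ (Fin 3)) := parabolicCylinderCentered 1 z₁ with hQs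
  have hQsub : Qs ⊆ stAffine (c ^ 2) c t x ⁻¹' Ω := by
    intro q hq
    simp only [hQs, parabolicCylinderCentered, hz₁, mem_prod, mem_Ioo, mem_ball] at hq
    obtain ⟨⟨hq1, hq2⟩, hq3⟩ := hq
    have hq1' : -2 < q.1 := by linarith
    have hq2' : q.1 < 0 := by linarith
    have hy : ‖q.2‖ < 1 := by simpa using hq3
    show stAffine (c ^ 2) c t x q ∈ Ω
    rw [show q = (q.1, q.2) from rfl, stAffine_apply]
    refine ⟨⟨?_, ?_⟩, ?_⟩
    · have hc2 : 0 < c ^ 2 := by positivity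
      have h1 : c ^ 2 * (-2) < c ^ 2 * q.1 := mul_lt_mul_of_pos_left hq1' hc2
      have h2 : c ^ 2 ≤ (1 / 8) ^ 2 := pow_le_pow_left₀ hc0.le hc8 2
      nlinarith
    · have : c ^ 2 * q.1 < 0 := mul_neg_of_pos_of_neg (by positivity) hq2'
      linarith [ht.2]
    · rw [mem_ball, dist_zero_right]
      calc ‖x + c • q.2‖ ≤ ‖x‖ + ‖c • q.2‖ := norm_add_le _ _
        _ = ‖x‖ + c * ‖q.2‖ := by rw [norm_smul, Real.norm_eq_abs, abs_of_pos hc0]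
        _ < ‖x‖ + c * 1 := by gcongr
        _ ≤ ϱ₀ + ϱ₀ / 4 := by rw [hc, hϱ₀]; linarith [Real.sqrt_nonneg (-t)]
        _ ≤ 1 := by linarith
  have hvcl : IsClassicalNSSolutionOnRegion Qs 1 0 v π :=
    hzoom.mono_of_isOpen hQsub (isOpen_parabolicCylinderCentered 1 z₁)
  -- the zoom is bounded by `C_u / 3`
  have hvbd : ∀ q ∈ Qs, ‖v q.1 q.2‖ ≤ Cu / 3 := by
    intro q hq
    have hq' := hQsub hq
    simp only [hQs, parabolicCylinderCentered, hz₁, mem_prod, mem_Ioo, mem_ball] at hq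
    obtain ⟨⟨hq1, hq2⟩, hq3⟩ := hq
    have hq2' : q.1 < 0 := by linarith
    have hy : ‖q.2‖ < 1 := by simpa using hq3
    have hmem : (t + c ^ 2 * q.1, x + c • q.2) ∈ Ω := by
      have := hq'; rwa [mem_preimage, show q = (q.1, q.2) from rfl, stAffine_apply] at this
    have hT := hTI (t + c ^ 2 * q.1) (Ioo_subset_Ico_self hmem.1) (x + c • q.2) hmem.2
    -- the denominator is at least `3c`
    have hden : 3 * c ≤ Real.sqrt (-(t + c ^ 2 * q.1)) + ‖x + c • q.2‖ := by
      have h1 : Real.sqrt (-t) ≤ Real.sqrt (-(t + c ^ 2 * q.1)) := by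
        refine Real.sqrt_le_sqrt ?_
        have : c ^ 2 * q.1 ≤ 0 := (mul_neg_of_pos_of_neg (by positivity) hq2').le
        linarith
      have h2 : ‖x‖ - c ≤ ‖x + c • q.2‖ := by
        have h3 : ‖x‖ ≤ ‖x + c • q.2‖ + ‖c • q.2‖ := by
          calc ‖x‖ = ‖(x + c • q.2) - c • q.2‖ := by rw [add_sub_cancel_right]
            _ ≤ ‖x + c • q.2‖ + ‖c • q.2‖ := norm_sub_le _ _
        have h4 : ‖c • q.2‖ ≤ c := by
          rw [norm_smul, Real.norm_eq_abs, abs_of_pos hc0]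
          calc c * ‖q.2‖ ≤ c * 1 := by gcongr
            _ = c := mul_one c
        linarith
      have h5 : Real.sqrt (-t) + ‖x‖ = 4 * c := by rw [hc, hϱ₀]; ring
      linarith
    have hden0 : 0 < Real.sqrt (-(t + c ^ 2 * q.1)) + ‖x + c • q.2‖ := lt_of_lt_of_le (by positivity) hden
    calc ‖v q.1 q.2‖ = c * ‖u (t + c ^ 2 * q.1) (x + c • q.2)‖ := by
          simp only [hv, Pi.smul_apply, stPull_apply, norm_smul, Real.norm_eq_abs, abs_of_pos hc0]
      _ ≤ c * (Cu / (Real.sqrt (-(t + c ^ 2 * q.1)) + ‖x + c • q.2‖)) :=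
          mul_le_mul_of_nonneg_left hT hc0.le
      _ ≤ c * (Cu / (3 * c)) := by
          refine mul_le_mul_of_nonneg_left (div_le_div_of_nonneg_left hCu (by positivity) hden) hc0.le
      _ = Cu / 3 := by field_simp
  -- Serrin's bound for the zoom below the top: `‖Dⁿ v(s, ·)(0)‖ ≤ K` for `s ∈ (-1/4, 0)`
  have hvD : ∀ s ∈ Ioo (-(1 / 4 : ℝ)) 0, ‖iteratedFDeriv ℝ n (v s) 0‖ ≤ K := by
    intro s hs
    have hq : ((s, (0 : EuclideanSpace ℝ (Fin 3))) : ℝ × EuclideanSpace ℝ (Fin 3)) ∈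
        Ioo (-(1 / 2 : ℝ) ^ 2) 0 ×ˢ ball (0 : EuclideanSpace ℝ (Fin 3)) (1 / 2) :=
      ⟨⟨by norm_num; linarith [hs.1], hs.2⟩, mem_ball_self (by norm_num)⟩
    exact hK v π hvcl hvbd (s, 0) hq
  -- undo the zoom: for `τ ∈ (t - c²/4, t)`, `‖Dⁿ u(τ, ·)(x)‖ ≤ K / c^{n+1}`
  have huD : ∀ τ ∈ Ioo (t - c ^ 2 / 4) t, ‖iteratedFDeriv ℝ n (u τ) x‖ ≤ K / c ^ (n + 1) := by
    intro τ hτ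
    set s : ℝ := (τ - t) / c ^ 2 with hs
    have hc2 : 0 < c ^ 2 := by positivity
    have hsI : s ∈ Ioo (-(1 / 4 : ℝ)) 0 := by
      rw [hs, mem_Ioo]
      constructor
      · rw [lt_div_iff₀ hc2]; linarith [hτ.1]
      · exact div_neg_of_neg_of_pos (by linarith [hτ.2]) hc2
    have hτeq : t + c ^ 2 * s = τ := by rw [hs]; field_simp; ring
    -- `u τ` as the un-zoomed slice
    set h : EuclideanSpace ℝ (Fin 3) → EuclideanSpace ℝ (Fin 3) := fun y => v s (c⁻¹ • y) with hh
    set g : EuclideanSpace ℝ (Fin 3) → EuclideanSpace ℝ (Fin 3) := fun w => c⁻¹ • h w with hg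
    have hfun : u τ = fun z => g (z - x) := by
      funext z
      show u τ z = c⁻¹ • (c • u (t + c ^ 2 * s) (x + c • (c⁻¹ • (z - x))))
      rw [hτeq, smul_smul, smul_smul, inv_mul_cancel₀ hc0.ne', mul_inv_cancel₀ hc0.ne', one_smul,
        one_smul, add_sub_cancel]
    -- smoothness of the slice `v s` near `0`
    have hvs : ContDiffAt ℝ n h (x - x) := by
      rw [sub_self, hh]
      have hmem : ((s, (0 : EuclideanSpace ℝ (Fin 3))) : ℝ × EuclideanSpace ℝ (Fin 3)) ∈ Qs := by
        simp only [hQs, parabolicCylinderCentered, hz₁, mem_prod, mem_Ioo, mem_ball, dist_self]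
        refine ⟨⟨by linarith [hsI.1], by linarith [hsI.2]⟩, by norm_num⟩
      have h1 : ContDiffAt ℝ ∞ (uncurry v) (s, 0) :=
        hvcl.smooth_velocity.contDiffAt ((isOpen_parabolicCylinderCentered 1 z₁).mem_nhds hmem)
      have h2 : ContDiffAt ℝ ∞ (v s) ((c⁻¹ : ℝ) • (0 : EuclideanSpace ℝ (Fin 3))) := by
        rw [smul_zero]
        exact h1.comp (0 : EuclideanSpace ℝ (Fin 3)) (contDiffAt_const.prodMk contDiffAt_id)
      exact (h2.comp 0 (contDiffAt_id.const_smul c⁻¹)).of_le (by exact_mod_cast le_top)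
    rw [hfun, iteratedFDeriv_comp_sub, hg, iteratedFDeriv_const_smul_apply' hvs, norm_smul, sub_self,
      Real.norm_eq_abs, abs_of_pos (inv_pos.2 hc0)]
    have h3 := norm_iteratedFDeriv_comp_smul_le' (v s) (inv_ne_zero hc0.ne') n (0 : EuclideanSpace ℝ (Fin 3))
    rw [smul_zero, abs_of_pos (inv_pos.2 hc0)] at h3
    calc c⁻¹ * ‖iteratedFDeriv ℝ n h 0‖
        ≤ c⁻¹ * (c⁻¹ ^ n * K) :=
          mul_le_mul_of_nonneg_left (h3.trans (mul_le_mul_of_nonneg_left (hvD s hsI) (by positivity)))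
            (inv_pos.2 hc0).le
      _ = K / c ^ (n + 1) := by rw [← mul_assoc, ← pow_succ', inv_pow, mul_comm, div_eq_mul_inv]
  -- pass to the top slice `τ = t` by continuity
  have hxB : x ∈ ball (0 : EuclideanSpace ℝ (Fin 3)) 1 := by
    rw [mem_ball, dist_zero_right]; linarith [Real.sqrt_nonneg (-t)]
  have hcont : ContinuousWithinAt (fun τ => iteratedFDeriv ℝ n (u τ) x) (Iio t) t := by
    have hj := continuousOn_iteratedFDeriv_slice (w := u) isOpen_Ioo isOpen_ball
      (hcl.smooth_velocity.mono hΩsub) n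
    have hgc : ContinuousAt (fun τ : ℝ => ((τ, x) : ℝ × EuclideanSpace ℝ (Fin 3))) t :=
      (continuous_id.prodMk continuous_const).continuousAt
    have hmemΩ : ((t, x) : ℝ × EuclideanSpace ℝ (Fin 3)) ∈ Ω := ⟨ht, hxB⟩
    have h1 : ContinuousAt ((fun q : ℝ × EuclideanSpace ℝ (Fin 3) => iteratedFDeriv ℝ n (u q.1) q.2) ∘
        (fun τ : ℝ => ((τ, x) : ℝ × EuclideanSpace ℝ (Fin 3)))) t :=
      ContinuousAt.comp (x := t) (hj.continuousAt (hΩo.mem_nhds hmemΩ)) hgc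
    exact h1.continuousWithinAt
  have hev : ∀ᶠ τ in 𝓝[<] t, ‖iteratedFDeriv ℝ n (u τ) x‖ ≤ K / c ^ (n + 1) := by
    have hmem : Ioo (t - c ^ 2 / 4) t ∈ 𝓝[<] t := Ioo_mem_nhdsLT (by nlinarith)
    filter_upwards [hmem] with τ hτ using huD τ hτ
  have hlim := le_of_tendsto (hcont.tendsto.norm) hev
  refine hlim.trans (le_of_eq ?_)
  rw [hc, div_pow, div_div_eq_mul_div]

end Serrin

end Summit.NavierStokesRegularity.NavierStokesRegularity.Theorems.ScalingDefectPeepholeDoor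

end
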